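import Literature.NumberTheory.LFunctions.ExplicitFormulaPsiCharContour
import HarnessLib

/-!
# The truncated explicit formula for `ψ(x, χ)`: the residue at `s = 0` and the constant `C(χ)`
# (Montgomery–Vaughan (12.7), (12.9))

Topic `Literature/NumberTheory/LFunctions`. THEOREMS (everything proved). Support file of the
discharge of `Literature.NumberTheory.LFunctions.truncatedExplicitFormula_psiChar`
(Montgomery–Vaughan Thm. 12.10). For a primitive character `χ` modulo `q > 1` we compute the residue
of `(−L'/L(s, χ)) x^s/s` at `s = 0` and identify it with the printed constant
`C(χ) = L'/L(1, χ̄) + log(q/2π) − C₀` of (12.7) (`explicitFormulaConst χ`):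

* odd `χ`: `L(0, χ) ≠ 0` and `−L'/L(0, χ) = C(χ)` (`logDeriv_LFunction_zero_of_odd`);
* even `χ`: `L(s, χ) = s · h(s)` with `h = L(s, χ)/s` entire, `h(0) = Λ(0, χ)/2 ≠ 0`, and
  `−h'/h(0) = C(χ)` (`exists_factor_even`).

Both follow from the logarithmic derivative of the functional equation at `s = 1`
(`ExplicitPsiChar.logDeriv_completed_one_sub`: `Λ'/Λ(0, χ) = −log q − Λ'/Λ(1, χ̄)`), from
`Γ_ℝ'/Γ_ℝ(s) = −½ log π + ½ ψ(s/2)` and the special values `ψ(1) = −C₀`, `ψ(1/2) = −C₀ − 2 log 2`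
(Mathlib's `Complex.digamma_one`, `Complex.digamma_one_half`); this is MV (12.9),
"`B(χ) = ... = −½ log(q/π) + (C₀/2) ... − L'/L(1, χ̄)`" in the form needed. Finally
`residue_data` packages, for each parity `a ∈ {0, 1}`, the factorisation `L = s^{m₀} h`, the
trivial-zero series `V` and the identity
`−(m₀ log x + h'/h(0)) + V = −½ log(x − 1) − (χ(−1)/2) log(x + 1) + C(χ)` (`x > 1`), which is the
shape of (12.6).

## References

* H. L. Montgomery, R. C. Vaughan, *Multiplicative Number Theory I. Classical Theory*, CUP 2007,
  §10.1 (10.35), Cor. 10.10; §12.1 Thm. 12.10, (12.6), (12.7), (12.9). [MontgomeryVaughan2007]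
-/

noncomputable section

open Complex Filter Set Topology
open scoped Real

namespace Literature.NumberTheory.LFunctions

namespace ExplicitPsiChar

open DirichletCharacter Literature.NumberTheory.LFunctions.SiegelZero ExplicitPsi PsiOneExplicit

variable {q : ℕ} [NeZero q] {χ : DirichletCharacter ℂ q}

/-! ### `Γ_ℝ'/Γ_ℝ` at `1` and `2` -/

/-- `Γ_ℝ'/Γ_ℝ(2) = −½ log π − C₀/2` (`ψ(1) = −C₀`). [folklore] -/
theorem logDeriv_Gammaℝ_two :
    logDeriv Gammaℝ 2 = -(Real.log π : ℂ) / 2 - Real.eulerMascheroniConstant / 2 := by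
  have hpole : ∀ m : ℕ, (2 : ℂ) / 2 ≠ -m := by
    intro m h
    have := congrArg Complex.re h
    simp at this
    linarith [(m.cast_nonneg : (0 : ℝ) ≤ m)]
  rw [logDeriv_Gammaℝ hpole, show (2 : ℂ) / 2 = 1 by norm_num, Complex.digamma_one,
    ← Complex.ofReal_log Real.pi_pos.le]
  ring

/-- `Γ_ℝ'/Γ_ℝ(1) = −½ log π − log 2 − C₀/2` (`ψ(1/2) = −C₀ − 2 log 2`). [folklore] -/
theorem logDeriv_Gammaℝ_one :
    logDeriv Gammaℝ 1 = -(Real.log π : ℂ) / 2 - Real.log 2 - Real.eulerMascheroniConstant / 2 := by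
  have hpole : ∀ m : ℕ, (1 : ℂ) / 2 ≠ -m := by
    intro m h
    have := congrArg Complex.re h
    simp at this
    linarith [(m.cast_nonneg : (0 : ℝ) ≤ m)]
  rw [logDeriv_Gammaℝ hpole, Complex.digamma_one_half, ← Complex.ofReal_log Real.pi_pos.le,
    show (Complex.log 2) = ((Real.log 2 : ℝ) : ℂ) by
      rw [show (2 : ℂ) = ((2 : ℝ) : ℂ) by norm_num, Complex.ofReal_log (by norm_num)]]
  ring

/-! ### `Λ'/Λ(0, χ)` by the functional equation -/

omit [NeZero q] in
/-- With the Gamma factor written as `Γ_ℝ(s + a)`: `γ'/γ(s, χ) = Γ_ℝ'/Γ_ℝ(s + a)` off the poles.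
[folklore] -/
theorem logDeriv_gammaFactor_of_eq (χ : DirichletCharacter ℂ q) {a : ℝ}
    (hGa : ∀ s : ℂ, gammaFactor χ s = Gammaℝ (s + a)) {s : ℂ} (hG : Gammaℝ (s + a) ≠ 0) :
    logDeriv (gammaFactor χ) s = logDeriv Gammaℝ (s + a) := by
  have hfun : gammaFactor χ = Gammaℝ ∘ fun z ↦ z + a := funext fun z ↦ hGa z
  have hpole : ∀ m : ℕ, (s + a) / 2 ≠ -m := by
    intro m h
    exact hG (Gammaℝ_eq_zero_iff.2 ⟨m, by linear_combination 2 * h⟩)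
  have hd : DifferentiableAt ℂ Gammaℝ (s + a) := (RealZeros.hasDerivAt_Gammaℝ hpole).differentiableAt
  rw [hfun, logDeriv_comp (by exact hd) (differentiableAt_id.add_const _)]
  simp

/-- **`Λ'/Λ(0, χ) = −log q − L'/L(1, χ̄) − Γ_ℝ'/Γ_ℝ(1 + a)`** for a primitive `χ` mod `q > 1` with
Gamma factor `Γ_ℝ(s + a)` (the functional equation differentiated at `s = 1`, where
`Λ(1, χ̄) = L(1, χ̄) Γ_ℝ(1 + a) ≠ 0`). [cite: MontgomeryVaughan2007, (10.35) and (12.9)] -/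
theorem logDeriv_completed_zero (hprim : χ.IsPrimitive) (hq : 1 < q) {a : ℝ} (ha : a = 0 ∨ a = 1)
    (hGa : ∀ s : ℂ, gammaFactor χ s = Gammaℝ (s + a)) :
    logDeriv (completedLFunction χ) 0 =
      -(Real.log q : ℂ) - logDeriv χ⁻¹.LFunction 1 - logDeriv Gammaℝ (1 + a) := by
  have hχ : χ ≠ 1 := ne_one_of_isPrimitive hprim hq
  have hχ' : χ⁻¹ ≠ 1 := mt inv_eq_one.mp hχ
  have hΛ1 : completedLFunction χ⁻¹ 1 ≠ 0 :=
    completedLFunction_ne_zero_of_one_le_re hχ' (by simp)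
  have h1 := logDeriv_completed_one_sub hprim hχ (s := 1) hΛ1
  rw [sub_self] at h1
  -- `Λ'/Λ(1, χ̄) = L'/L(1, χ̄) + Γ_ℝ'/Γ_ℝ(1 + a)`
  have hG1 : gammaFactor χ⁻¹ 1 ≠ 0 := gammaFactor_ne_zero_of_re_pos χ⁻¹ (by simp)
  have h2 := logDeriv_LFunction_eq hχ' hΛ1 hG1
  have hGa' : ∀ s : ℂ, gammaFactor χ⁻¹ s = Gammaℝ (s + a) := fun s ↦ by rw [gammaFactor_inv, hGa]
  have hGr : Gammaℝ (1 + a) ≠ 0 := Gammaℝ_ne_zero_of_re_pos (by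
    simp; rcases ha with rfl | rfl <;> norm_num)
  rw [logDeriv_gammaFactor_of_eq χ⁻¹ hGa' hGr] at h2
  rw [h1, h2]
  ring

/-! ### Odd characters: `−L'/L(0, χ) = C(χ)` -/

/-- **MV (12.9), odd case**: for an odd primitive `χ` mod `q > 1`, `L(0, χ) ≠ 0` and
`L'/L(0, χ) = −C(χ) = −(L'/L(1, χ̄) + log(q/2π) − C₀)`. [cite: MontgomeryVaughan2007, (12.7) and (12.9)] -/
theorem logDeriv_LFunction_zero_of_odd (hprim : χ.IsPrimitive) (hq : 1 < q) (hodd : χ.Odd) :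
    χ.LFunction 0 ≠ 0 ∧ logDeriv χ.LFunction 0 = -explicitFormulaConst χ := by
  have hχ : χ ≠ 1 := ne_one_of_isPrimitive hprim hq
  refine ⟨LFunction_zero_ne_zero_of_odd hprim hχ hodd, ?_⟩
  have hGa : ∀ s : ℂ, gammaFactor χ s = Gammaℝ (s + (1 : ℝ)) := fun s ↦ by
    rw [hodd.gammaFactor_def]; simp
  have hΛ0 : completedLFunction χ 0 ≠ 0 := completedLFunction_ne_zero_of_re_nonpos hprim hχ (by simp)
  have hG0 : gammaFactor χ 0 ≠ 0 := by rw [hodd.gammaFactor_def, zero_add, Gammaℝ_one]; exact one_ne_zero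
  rw [logDeriv_LFunction_eq hχ hΛ0 hG0, logDeriv_completed_zero hprim hq (Or.inr rfl) hGa,
    logDeriv_gammaFactor_of_eq χ hGa (by simp [Gammaℝ_one]), explicitFormulaConst]
  simp only [ofReal_one, zero_add, show (1 : ℂ) + 1 = 2 by norm_num]
  rw [logDeriv_Gammaℝ_one, logDeriv_Gammaℝ_two, logDeriv_apply]
  have hq0 : (0 : ℝ) < q := by exact_mod_cast (lt_trans zero_lt_one hq)
  have hlog : ((Real.log (q / (2 * π)) : ℝ) : ℂ) = Real.log q - Real.log 2 - Real.log π := by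
    rw [Real.log_div hq0.ne' (by positivity), Real.log_mul two_ne_zero Real.pi_pos.ne']
    push_cast; ring
  rw [hlog]
  ring

/-! ### Even characters: `L(s, χ) = s · h(s)`, `−h'/h(0) = C(χ)` -/

/-- **MV (12.9), even case**: for an even primitive `χ` mod `q > 1` there is an entire `h` with
`L(s, χ) = s · h(s)`, `h(0) ≠ 0` (`= Λ(0, χ)/2`), and `h'/h(0) = −C(χ)`; namely `h = L(s, χ)/s`
(Mathlib's `dslope`), which near `0` is `Λ(s, χ)/E(s)` with `E(s) = s Γ_ℝ(s) = 2π^{−s/2}Γ(s/2 + 1)`,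
`E'/E(0) = −½ log π + ½ ψ(1)`. [cite: MontgomeryVaughan2007, (12.7) and (12.9)] -/
theorem exists_factor_even (hprim : χ.IsPrimitive) (hq : 1 < q) (heven : χ.Even) :
    ∃ h : ℂ → ℂ, Differentiable ℂ h ∧ h 0 ≠ 0 ∧ (∀ s : ℂ, χ.LFunction s = s ^ 1 * h s) ∧
      logDeriv h 0 = -explicitFormulaConst χ := by
  have hχ : χ ≠ 1 := ne_one_of_isPrimitive hprim hq
  have hq1 : q ≠ 1 := level_ne_one hχ
  have hL0 : χ.LFunction 0 = 0 := LFunction_zero_eq_zero_of_even hprim hχ heven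
  -- `h = L(s, χ)/s`
  obtain ⟨h, hhdef⟩ : ∃ h : ℂ → ℂ, h = dslope χ.LFunction 0 := ⟨_, rfl⟩
  -- `L = s · h`
  have hLh : ∀ s : ℂ, χ.LFunction s = s ^ 1 * h s := by
    intro s
    have := sub_smul_dslope χ.LFunction 0 s
    rw [sub_zero, smul_eq_mul, hL0, sub_zero] at this
    rw [pow_one, hhdef, this]
  -- `h` is entire
  have hhd : Differentiable ℂ h := by
    have := (Complex.differentiableOn_dslope (univ_mem : (univ : Set ℂ) ∈ 𝓝 (0 : ℂ))).2
      (differentiable_LFunction hχ).differentiableOn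
    rw [hhdef]
    exact differentiableOn_univ.1 this
  -- the function `E(s) = 2 π^{-s/2} Γ(s/2 + 1)` (entire near `0`), `E = s Γ_ℝ(s)` off `0`
  obtain ⟨E, hEdef⟩ : ∃ E : ℂ → ℂ, E = fun s ↦ 2 * ((π : ℂ) ^ (-s / 2) * Complex.Gamma (s / 2 + 1)) :=
    ⟨_, rfl⟩
  have hπ0 : (π : ℂ) ≠ 0 := by exact_mod_cast Real.pi_ne_zero
  have hE0 : E 0 = 2 := by rw [hEdef]; simp [Complex.Gamma_one]
  have hEeq : ∀ s : ℂ, s ≠ 0 → E s = s * Gammaℝ s := by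
    intro s hs
    rw [hEdef, Gammaℝ_def]
    simp only
    rw [Complex.Gamma_add_one _ (div_ne_zero hs two_ne_zero)]
    ring
  have hnopole : ∀ s : ℂ, ‖s‖ < 1 → ∀ m : ℕ, s / 2 + 1 ≠ -m := by
    intro s hs m hm
    have := congrArg Complex.re hm
    simp at this
    have hre : |s.re| < 1 := lt_of_le_of_lt (Complex.abs_re_le_norm s) hs
    rw [abs_lt] at hre
    linarith [(m.cast_nonneg : (0 : ℝ) ≤ m)]
  have hEd : ∀ s : ℂ, ‖s‖ < 1 → DifferentiableAt ℂ E s := by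
    intro s hs
    rw [hEdef]
    have h1 : DifferentiableAt ℂ (fun s : ℂ ↦ (π : ℂ) ^ (-s / 2)) s :=
      ((differentiableAt_id.neg).div_const 2).const_cpow (Or.inl hπ0)
    have h2 : DifferentiableAt ℂ (fun s : ℂ ↦ Complex.Gamma (s / 2 + 1)) s :=
      (Complex.differentiableAt_Gamma _ (hnopole s hs)).comp s
        ((differentiableAt_id.div_const 2).add_const 1)
    exact (h1.mul h2).const_mul _
  -- `h = Λ/E` on the punctured ball `0 < |s| < 1`
  obtain ⟨F, hFdef⟩ : ∃ F : ℂ → ℂ, F = fun s ↦ completedLFunction χ s / E s := ⟨_, rfl⟩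
  have hpunct : ∀ s : ℂ, s ≠ 0 → ‖s‖ < 1 → h s = F s := by
    intro s hs hs1
    have h1 : h s = χ.LFunction s / s := by
      rw [hhdef, dslope_of_ne _ hs, slope_def_field, hL0, sub_zero, sub_zero]
    rw [h1, hFdef]
    simp only
    rw [LFunction_eq_completed_div_gammaFactor χ s (Or.inr hq1), heven.gammaFactor_def, hEeq s hs,
      div_div]
    congr 1; ring
  -- ... hence, both sides being continuous at `0`, on the whole ball
  have hFc : ContinuousAt F 0 := by
    rw [hFdef]
    have hΛ : ContinuousAt (completedLFunction χ) 0 := (differentiable_completedLFunction hχ 0).continuousAt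
    exact hΛ.div (hEd 0 (by simp)).continuousAt (by rw [hE0]; exact two_ne_zero)
  have hval : h 0 = F 0 := by
    have ht1 : Tendsto h (𝓝[≠] 0) (𝓝 (h 0)) := (hhd 0).continuousAt.continuousWithinAt.tendsto
    have ht2 : Tendsto F (𝓝[≠] 0) (𝓝 (F 0)) := hFc.continuousWithinAt.tendsto
    have heq : h =ᶠ[𝓝[≠] (0 : ℂ)] F := by
      have hball : Metric.ball (0 : ℂ) 1 ∈ 𝓝 (0 : ℂ) := Metric.ball_mem_nhds _ one_pos
      filter_upwards [mem_nhdsWithin_of_mem_nhds hball, self_mem_nhdsWithin] with s hs hs0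
      exact hpunct s hs0 (by simpa using hs)
    exact tendsto_nhds_unique (ht1.congr' heq) ht2
  have hev : h =ᶠ[𝓝 (0 : ℂ)] F := by
    have hball : Metric.ball (0 : ℂ) 1 ∈ 𝓝 (0 : ℂ) := Metric.ball_mem_nhds _ one_pos
    filter_upwards [hball] with s hs
    by_cases hs0 : s = 0
    · rw [hs0]; exact hval
    · exact hpunct s hs0 (by simpa using hs)
  -- values and logarithmic derivatives at `0`
  have hΛ0 : completedLFunction χ 0 ≠ 0 := completedLFunction_ne_zero_of_re_nonpos hprim hχ (by simp)
  have hE0' : E 0 ≠ 0 := by rw [hE0]; exact two_ne_zero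
  have hh0 : h 0 ≠ 0 := by
    rw [hval, hFdef]
    exact div_ne_zero hΛ0 hE0'
  refine ⟨h, hhd, hh0, hLh, ?_⟩
  rw [logDeriv_congr_of_eventuallyEq hev, hFdef,
    logDeriv_div 0 hΛ0 hE0' (differentiable_completedLFunction hχ 0) (hEd 0 (by simp))]
  -- `E'/E(0) = -log π / 2 + ψ(1)/2 = -log π / 2 - C₀/2`
  have hlogE : logDeriv E 0 = -(Real.log π : ℂ) / 2 - Real.eulerMascheroniConstant / 2 := by
    have hf : HasDerivAt (fun s : ℂ ↦ -s / 2) (-1 / 2) 0 := ((hasDerivAt_id' (0 : ℂ)).neg).div_const 2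
    have hd1 : HasDerivAt (fun s : ℂ ↦ (π : ℂ) ^ (-s / 2))
        ((π : ℂ) ^ (-(0 : ℂ) / 2) * Complex.log π * (-1 / 2)) 0 := hf.const_cpow (Or.inl hπ0)
    have hg : HasDerivAt (fun s : ℂ ↦ s / 2 + 1) (1 / 2) 0 := ((hasDerivAt_id' (0 : ℂ)).div_const 2).add_const 1
    have hΓ : HasDerivAt Complex.Gamma (deriv Complex.Gamma 1) ((0 : ℂ) / 2 + 1) := by
      rw [zero_div, zero_add]
      exact (Complex.differentiableAt_Gamma 1 (by simpa using hnopole 0 (by simp))).hasDerivAt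
    have hd2 : HasDerivAt (fun s : ℂ ↦ Complex.Gamma (s / 2 + 1)) (deriv Complex.Gamma 1 * (1 / 2)) 0 :=
      hΓ.comp 0 hg
    have hd : HasDerivAt (fun s : ℂ ↦ 2 * ((π : ℂ) ^ (-s / 2) * Complex.Gamma (s / 2 + 1)))
        (2 * (((π : ℂ) ^ (-(0 : ℂ) / 2) * Complex.log π * (-1 / 2)) * Complex.Gamma ((0 : ℂ) / 2 + 1) +
          (π : ℂ) ^ (-(0 : ℂ) / 2) * (deriv Complex.Gamma 1 * (1 / 2)))) 0 :=
      (hd1.mul hd2).const_mul 2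
    have hψ : deriv Complex.Gamma 1 = -Real.eulerMascheroniConstant := by
      have := Complex.digamma_one
      rwa [Complex.digamma_def, logDeriv_apply, Complex.Gamma_one, div_one] at this
    rw [logDeriv_apply, hE0, hEdef, hd.deriv, hψ, ← Complex.ofReal_log Real.pi_pos.le, neg_zero,
      zero_div, cpow_zero, zero_add, Complex.Gamma_one]
    ring
  have hGa : ∀ s : ℂ, gammaFactor χ s = Gammaℝ (s + (0 : ℝ)) := fun s ↦ by
    rw [heven.gammaFactor_def]; simp
  rw [hlogE, logDeriv_completed_zero hprim hq (Or.inl rfl) hGa, explicitFormulaConst]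
  simp only [ofReal_zero, add_zero]
  rw [logDeriv_Gammaℝ_one, logDeriv_apply]
  have hq0 : (0 : ℝ) < q := by exact_mod_cast (lt_trans zero_lt_one hq)
  have hlog : ((Real.log (q / (2 * π)) : ℝ) : ℂ) = Real.log q - Real.log 2 - Real.log π := by
    rw [Real.log_div hq0.ne' (by positivity), Real.log_mul two_ne_zero Real.pi_pos.ne']
    push_cast; ring
  rw [hlog]
  ring

/-! ### The elementary logarithms -/

/-- `−½ log(1 − 1/x²) − log x = −½ log(x − 1) − ½ log(x + 1)` (`x > 1`). [folklore] -/
theorem log_identity_even {x : ℝ} (hx : 1 < x) :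
    -(1 / 2) * Real.log (1 - 1 / x ^ 2) - Real.log x =
      -(1 / 2) * Real.log (x - 1) - 1 / 2 * Real.log (x + 1) := by
  have hx0 : 0 < x := by linarith
  have h1 : 1 - 1 / x ^ 2 = (x - 1) * (x + 1) / x ^ 2 := by field_simp; ring
  rw [h1, Real.log_div (by positivity) (by positivity), Real.log_mul (by linarith) (by linarith),
    Real.log_pow]
  push_cast
  ring

/-- `½ (log(1 + 1/x) − log(1 − 1/x)) = −½ log(x − 1) + ½ log(x + 1)` (`x > 1`). [folklore] -/
theorem log_identity_odd {x : ℝ} (hx : 1 < x) :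
    1 / 2 * (Real.log (1 + 1 / x) - Real.log (1 - 1 / x)) =
      -(1 / 2) * Real.log (x - 1) + 1 / 2 * Real.log (x + 1) := by
  have hx0 : 0 < x := by linarith
  have h1 : 1 + 1 / x = (x + 1) / x := by field_simp
  have h2 : 1 - 1 / x = (x - 1) / x := by field_simp
  rw [h1, h2, Real.log_div (by linarith) hx0.ne', Real.log_div (by linarith) hx0.ne']
  ring

/-! ### The residue data, packaged for the assembly -/

/-- **The residue data at `s = 0`.** For a primitive `χ` mod `q > 1` there are `m₀ ∈ {0, 1}`, an
entire `h` with `h(0) ≠ 0` and `L(s, χ) = s^{m₀} h(s)`, and the parity `a ∈ {0, 1}` with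
`γ(s, χ) = Γ_ℝ(s + a)`, such that for every `x > 1` the trivial-zero series
`∑_k x^{−(2k+2−a)}/(2k+2−a)` has a sum `V` with
`−(m₀ log x + h'/h(0)) + V = −½ log(x − 1) − (χ(−1)/2) log(x + 1) + C(χ)`:
the right-hand side of (12.6) apart from the zeros and the remainder.
[cite: MontgomeryVaughan2007, Theorem 12.10 (12.6)–(12.7), (12.9)] -/
theorem residue_data (hprim : χ.IsPrimitive) (hq : 1 < q) :
    ∃ (m₀ : ℕ) (h : ℂ → ℂ) (a : ℝ), Differentiable ℂ h ∧ h 0 ≠ 0 ∧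
      (∀ s : ℂ, χ.LFunction s = s ^ m₀ * h s) ∧ (a = 0 ∨ a = 1) ∧
      (∀ s : ℂ, gammaFactor χ s = Gammaℝ (s + a)) ∧
      ∀ x : ℝ, 1 < x → ∃ V : ℂ,
        HasSum (fun k : ℕ ↦ (x : ℂ) ^ (-(2 * (k : ℂ) + 2 - a)) / (2 * (k : ℂ) + 2 - a)) V ∧
        -((m₀ : ℂ) * Real.log x + logDeriv h 0) + V =
          -(1 / 2 * ((Real.log (x - 1) : ℝ) : ℂ)) - χ (-1) / 2 * ((Real.log (x + 1) : ℝ) : ℂ) +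
            explicitFormulaConst χ := by
  rcases χ.even_or_odd with heven | hodd
  · obtain ⟨h, hhd, hh0, hLh, hlog⟩ := exists_factor_even hprim hq heven
    have hGa : ∀ s : ℂ, gammaFactor χ s = Gammaℝ (s + (0 : ℝ)) := fun s ↦ by
      rw [heven.gammaFactor_def]; simp
    refine ⟨1, h, 0, hhd, hh0, hLh, Or.inl rfl, hGa, fun x hx ↦ ⟨_, hasSum_trivialZeroTerm_even hx, ?_⟩⟩
    have hχ1 : χ (-1) = 1 := heven
    rw [hlog, hχ1]
    have := log_identity_even hx
    have e : (((-(1 / 2) * Real.log (1 - 1 / x ^ 2) : ℝ)) : ℂ) - ((Real.log x : ℝ) : ℂ) =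
        -(1 / 2) * ((Real.log (x - 1) : ℝ) : ℂ) - 1 / 2 * ((Real.log (x + 1) : ℝ) : ℂ) := by
      have := congrArg (fun r : ℝ ↦ (r : ℂ)) this
      push_cast at this ⊢
      exact this
    push_cast at e ⊢
    linear_combination e
  · obtain ⟨hL0, hlog⟩ := logDeriv_LFunction_zero_of_odd hprim hq hodd
    have hGa : ∀ s : ℂ, gammaFactor χ s = Gammaℝ (s + (1 : ℝ)) := fun s ↦ by
      rw [hodd.gammaFactor_def]; simp
    refine ⟨0, χ.LFunction, 1, differentiable_LFunction (ne_one_of_isPrimitive hprim hq), hL0,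
      fun s ↦ by simp, Or.inr rfl, hGa, fun x hx ↦ ⟨_, hasSum_trivialZeroTerm_odd hx, ?_⟩⟩
    have hχ1 : χ (-1) = -1 := hodd
    rw [hlog, hχ1]
    have := log_identity_odd hx
    have e : (((1 / 2 * (Real.log (1 + 1 / x) - Real.log (1 - 1 / x))) : ℝ) : ℂ) =
        -(1 / 2) * ((Real.log (x - 1) : ℝ) : ℂ) + 1 / 2 * ((Real.log (x + 1) : ℝ) : ℂ) := by
      have := congrArg (fun r : ℝ ↦ (r : ℂ)) this
      push_cast at this ⊢
      exact this
    push_cast at e ⊢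
    linear_combination e

end ExplicitPsiChar

end Literature.NumberTheory.LFunctions

end
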